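/-
Copyright (c) 2026 the pub-hodgecm-mathlib formalisation cell (harness21).  Prover seat hodgecm-mathlib-LH4-p01 (g10): road M6 → F3 «TOT-Λ BY OVER-ORDERS» (LEAD F0P3a-plan
T14-66), F3-5 pen LH7-p04 (g12) DEAL D′ 01:23:47Z «THE TYPE-(2) ORDER OF A ⋆-STABLE PAIR», FILE D′α; 2026-09-03.
-/
import Literature.NumberTheory.Automorphic.GluedOverOrderOfUnitaryPair   -- ★ (c6) FILE 2 p853079 (this seat): `eval₂_mem_range_eval₂_of_mem`, `map_sub_mem_span_of_image_prodMap_subset`, `exists_map_rep_of_level`; brings ★ (c6) FILE 1 `exists_coe_range_eval₂_eq_glued`, `level_of_eisenstein_pair(_of_deep)`, ★ F3-1a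
import HarnessLib

/-!
# The glued order of a `⋆`-stable Eisenstein pair: ★ (c6) FILE 2 with the unitarity binder weakened to «`x⋆ ∈ 𝒪_E[x]`»
# (Neukirch I §12; Serre, Corps locaux I §6, X §1; Jacobowitz §4, §7; Rogawski 1990 §4.9)

Topic `NumberTheory/Automorphic`; namespace `Literature.NumberTheory.Automorphic`.  THEOREMS ONLY (no definition, no instance, no notation, no named fact, no `sorry`); kernel lane
`--supports stmt-HodgeConjecture-24833`.  Cell `pub/hodgecm-mathlib` (D-0151), crux H413 = `stmt-HodgeConjecture-24833`; road M6 → F3 «TOT-Λ by over-orders» (route (B)); F3-5 pen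
LH7-p04 (g12) DEAL D′ (D′1): ★ (W1) `ncard_vertex_rowZero_eq_of_total` evaluates the TOT-Λ binder `hT` at the SHIFTED pair `ϖ⁻¹(x − 1)`, which is NOT unitary, so the F3-5
spine must run on a shift-stable side condition; «`x⋆ = P(x)` for an integral polynomial `P`», i.e. `x⋆ ∈ R = 𝒪_E[x]`, is one (FILE D′β `TypeTwoPairStarPolynomial`:
unitary ⇒ ⋆-polynomial; ⋆-polynomial and `x ≡ 1 (ϖ)` ⇒ the shift has a ⋆-polynomial).  This file re-cuts ★ (c6) FILE 2 `GluedOverOrderOfUnitaryPair` accordingly: the ONLY use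
of unitarity there was `x⋆ = x⁻¹ ∈ R` (★ (L2′) inverse-closedness), so with `hstarmem : x⋆ ∈ R` as the binder the proofs are unchanged — `⋆R ⊆ R` (§1), hence the character
is hermitian and has a `σO`-fixed representative at the same monogenic level (§2, ★ (c6) FILE 2's `map_sub_mem_span_of_image_prodMap_subset` ∕ `exists_map_rep_of_level` by
name).  The binder `hk₀` of ★ (c6) FILE 2 disappears (it served only the inverse).
HONEST LABEL: HC_CM is proved only modulo the 7 printed citations (2 remaining named inputs: hLiu418 = stmt-HodgeConjecture-24832, h413 = stmt-HodgeConjecture-24833) until rung 0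
closes; commutative algebra, count-neutral (pays no organ, opens no road; zero label movement until F5 ★ + a desk-priced rider).
[cite: Neukirch1999, Ch. I §12] [cite: SerreLocalFields1979, Ch. I §6 Prop. 17–18; Ch. X §1] [cite: Jacobowitz1962, §4, §7] [cite: Rogawski1990, §4.9 Lemma 4.9.3 p. 56, Prop. 4.9.1 (b) p. 55]

* §1 **`image_prodMap_range_eval₂_subset_of_mem`** (`x⋆ ∈ R ⇒ ⋆R ⊆ R`, any commutative `O₁`), `image_prodMap_range_eval₂_eq_self_of_mem` (`⋆R = R`);
* §2 **`exists_coe_range_eval₂_eq_glued_map_of_star_mem`**, **`exists_coe_range_eval₂_eq_glued_map_of_deep_of_star_mem`** (★ (c6) FILE 2's heads, `hxstar ↦ hstarmem`).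

## References
* [Neukirch1999] J. Neukirch, *Algebraic Number Theory*, Grundlehren 322 (1999): Ch. I §12.
* [SerreLocalFields1979] J.-P. Serre, *Local Fields*, GTM 67 (1979): Ch. I §6 Prop. 17–18; Ch. X §1.
* [Jacobowitz1962] R. Jacobowitz, *Hermitian forms over local fields*, Amer. J. Math. 84 (1962): §4, §7.
* [Rogawski1990] J. D. Rogawski, *Automorphic Representations of Unitary Groups in Three Variables*, Ann. of Math. Stud. 123 (1990): §4.9 Lemma 4.9.3 p. 56, Prop. 4.9.1 (b) p. 55.
-/

set_option autoImplicit false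

noncomputable section

open scoped ValuativeRel
open Polynomial ValuativeRel

namespace Literature.NumberTheory.Automorphic

variable {E : Type*} [Field E] [ValuativeRel E] {O₁ : Type*} [CommRing O₁] (j : 𝒪[E] →+* O₁) (θ : O₁)

section Star

variable (σO : 𝒪[E] →+* 𝒪[E]) (σ₁ : O₁ →+* O₁)

/-! ## §1 `x⋆ ∈ R ⇒ ⋆R ⊆ R` -/

/-- **`⋆R ⊆ R` FROM `x⋆ ∈ R`**: if `⋆ = (σO, σ₁)` with `σ₁ ∘ j = j ∘ σO` and `x⋆ ∈ R = 𝒪[x]` then `⋆(f(x)) = f^{σO}(x⋆) ∈ R` for every `f` — the involution maps `R` into itself.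
Any commutative `O₁`, no Eisenstein structure needed. [cite: Jacobowitz1962, §4] [cite: Neukirch1999, Ch. I §12] -/
theorem image_prodMap_range_eval₂_subset_of_mem (hσ₁j : ∀ x, σ₁ (j x) = j (σO x)) {u : 𝒪[E]} {lam : O₁}
    (hstarmem : RingHom.prodMap σO σ₁ ((u, lam) : 𝒪[E] × O₁) ∈ (Polynomial.eval₂RingHom (RingHom.prod (RingHom.id 𝒪[E]) j) ((u, lam) : 𝒪[E] × O₁)).range) :
    RingHom.prodMap σO σ₁ '' ((Polynomial.eval₂RingHom (RingHom.prod (RingHom.id 𝒪[E]) j) ((u, lam) : 𝒪[E] × O₁)).range : Set (𝒪[E] × O₁)) ⊆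
      (Polynomial.eval₂RingHom (RingHom.prod (RingHom.id 𝒪[E]) j) ((u, lam) : 𝒪[E] × O₁)).range := by
  have hcomp : (RingHom.prodMap σO σ₁).comp (RingHom.prod (RingHom.id 𝒪[E]) j) = (RingHom.prod (RingHom.id 𝒪[E]) j).comp σO := by
    refine RingHom.ext fun c => Prod.ext ?_ ?_
    · simp
    · simp [hσ₁j]
  rintro _ ⟨z, hz, rfl⟩
  obtain ⟨f, rfl⟩ := hz
  rw [Polynomial.coe_eval₂RingHom, Polynomial.hom_eval₂, hcomp, ← Polynomial.eval₂_map]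
  exact eval₂_mem_range_eval₂_of_mem j hstarmem (f.map σO)

/-- **`⋆R = R` FROM `x⋆ ∈ R`** (with `σO`, hence `σ₁`, an involution on the Eisenstein ring `O₁ = j𝒪 ⊕ j𝒪θ`). [cite: Jacobowitz1962, §4] [cite: Neukirch1999, Ch. I §12] -/
theorem image_prodMap_range_eval₂_eq_self_of_mem (hcoord : ∀ z : O₁, ∃! bc : 𝒪[E] × 𝒪[E], z = j bc.1 + j bc.2 * θ)
    (hσσ : ∀ x, σO (σO x) = x) (hσ₁j : ∀ x, σ₁ (j x) = j (σO x)) (hσ₁θ : σ₁ θ = θ) {u : 𝒪[E]} {lam : O₁}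
    (hstarmem : RingHom.prodMap σO σ₁ ((u, lam) : 𝒪[E] × O₁) ∈ (Polynomial.eval₂RingHom (RingHom.prod (RingHom.id 𝒪[E]) j) ((u, lam) : 𝒪[E] × O₁)).range) :
    RingHom.prodMap σO σ₁ '' ((Polynomial.eval₂RingHom (RingHom.prod (RingHom.id 𝒪[E]) j) ((u, lam) : 𝒪[E] × O₁)).range : Set (𝒪[E] × O₁)) =
      (Polynomial.eval₂RingHom (RingHom.prod (RingHom.id 𝒪[E]) j) ((u, lam) : 𝒪[E] × O₁)).range := by
  have hσ₁σ₁ : ∀ w : O₁, σ₁ (σ₁ w) = w := by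
    intro w
    obtain ⟨⟨b₁, c₁⟩, hw, -⟩ := hcoord w
    rw [hw]
    simp only [map_add, map_mul, hσ₁j, hσ₁θ, hσσ]
  have hinv : ∀ w : 𝒪[E] × O₁, RingHom.prodMap σO σ₁ (RingHom.prodMap σO σ₁ w) = w := by
    rintro ⟨y, x⟩; ext <;> simp [hσσ, hσ₁σ₁]
  have hsub := image_prodMap_range_eval₂_subset_of_mem j σO σ₁ hσ₁j hstarmem
  refine Set.Subset.antisymm hsub fun w hw => ?_
  exact ⟨RingHom.prodMap σO σ₁ w, hsub ⟨w, hw, rfl⟩, hinv w⟩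

/-! ## §2 HEADS: ★ (c6) FILE 2 with `hxstar ↦ hstarmem` -/

variable {F : Type*} [Field F] [ValuativeRel F] (ιO : 𝒪[F] →+* 𝒪[E])

/-- **(D′1) HEAD — A `⋆`-STABLE EISENSTEIN PAIR GENERATES A GLUED ORDER WITH A FIXED CHARACTER AT A MONOGENIC LEVEL.**  In the inert Eisenstein frame of ★ (UG) ∕ ★ (L3′)
(`ιO σO` the unramified base with `hfixO`, `htr`; `O₁ = j𝒪_E ⊕ j𝒪_E θ`, `θ² = j(ιO a)θ + j(ιO k)`, `a ∈ 𝔪_F`, `k` a uniformiser class, `σ₁ θ = θ`; uniformisers `ιO ϖ_F = ϖ`):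
for `x = (u, j p + j q θ)` with `x⋆ ∈ 𝒪_E[x]` (`⋆ = (σO, σ₁)`; e.g. `x` unitary, ★ (c6), OR the shift `ϖ⁻¹(x − 1)` of a ⋆-polynomial pair, ★ D′β) and with `λ² − tλ + D = 0`, `v(q) = v(ϖ)^N`, `v(u² − tu + D) = v(ϖ)^n`, there is `y ∈ 𝒪_F` with
`𝒪_E[x] = G(N, n, ιO y)` (★ F3-1a's literal) and EITHER `n = 2N+1 ∧ y ∈ (ϖ_F^{N+1})` OR `n = 2M`, `M ≤ N`, `y ∈ (ϖ_F^M) ∖ (ϖ_F^{M+1})` (`M = 0`: the product order `𝒪 × O_N`).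
★ (c6) `exists_coe_range_eval₂_eq_glued_map` with the unitarity binder `hxstar` weakened to `hstarmem` (the shift-stable form F5's `hC ∕ hCg′` needs; F3-5 pen LH7-p04 (g12) DEAL D′); `hk₀` is no longer needed. [cite: Rogawski1990, §4.9 Lemma 4.9.3 p. 56, Prop. 4.9.1 (b) p. 55] [cite: Neukirch1999, Ch. I §12] [cite: Jacobowitz1962, §7] [cite: SerreLocalFields1979, Ch. I §6 Prop. 17–18; Ch. X §1] -/
theorem exists_coe_range_eval₂_eq_glued_map_of_star_mem {aF k₀F : 𝒪[F]}
    (hσσ : ∀ x, σO (σO x) = x) (hσι : ∀ y, σO (ιO y) = ιO y) (hfixO : ∀ x, σO x = x → ∃ y, ιO y = x)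
    (hιu : ∀ y, IsUnit (ιO y) → IsUnit y) (hσ₁j : ∀ x, σ₁ (j x) = j (σO x)) (hσ₁θ : σ₁ θ = θ)
    (hθ : θ ^ 2 = j (ιO aF) * θ + j (ιO k₀F)) (haF : aF ∈ IsLocalRing.maximalIdeal 𝒪[F])
    (hcoord : ∀ z : O₁, ∃! bc : 𝒪[E] × 𝒪[E], z = j bc.1 + j bc.2 * θ) (htr : ∃ b₀ : 𝒪[E], b₀ + σO b₀ = 1)
    {ϖF : F} {ϖ : E} (hϖF : IsUniformizingElement ϖF) (hϖ : IsUniformizingElement ϖ) (hιϖ : ιO ⟨ϖF, hϖF.mem⟩ = ⟨ϖ, hϖ.mem⟩)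
    (hk₁ : valuation E ((ιO k₀F : 𝒪[E]) : E) = valuation E ϖ) {u p q t D : 𝒪[E]}
    (hlam2 : (j p + j q * θ) ^ 2 - j t * (j p + j q * θ) + j D = 0)
    (hstarmem : RingHom.prodMap σO σ₁ ((u, j p + j q * θ) : 𝒪[E] × O₁) ∈
      (Polynomial.eval₂RingHom (RingHom.prod (RingHom.id 𝒪[E]) j) ((u, j p + j q * θ) : 𝒪[E] × O₁)).range) {N n : ℕ}
    (hN : valuation E (q : E) = valuation E ϖ ^ N) (hn : valuation E ((u * u - t * u + D : 𝒪[E]) : E) = valuation E ϖ ^ n) :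
    ∃ y : 𝒪[F],
      ((Polynomial.eval₂RingHom (RingHom.prod (RingHom.id 𝒪[E]) j) ((u, j p + j q * θ) : 𝒪[E] × O₁)).range : Set (𝒪[E] × O₁)) =
        {z : 𝒪[E] × O₁ | ∃ b₀ c₀ : 𝒪[E], z.2 = j b₀ + j c₀ * (j ((⟨ϖ, hϖ.mem⟩ : 𝒪[E]) ^ N) * θ) ∧
          z.1 - (b₀ + c₀ * ιO y) ∈ Ideal.span {(⟨ϖ, hϖ.mem⟩ : 𝒪[E]) ^ n}} ∧
      ((n = 2 * N + 1 ∧ y ∈ Ideal.span {(⟨ϖF, hϖF.mem⟩ : 𝒪[F]) ^ (N + 1)}) ∨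
        ∃ M : ℕ, M ≤ N ∧ n = 2 * M ∧ y ∈ Ideal.span {(⟨ϖF, hϖF.mem⟩ : 𝒪[F]) ^ M} ∧
          y ∉ Ideal.span {(⟨ϖF, hϖF.mem⟩ : 𝒪[F]) ^ (M + 1)}) := by
  set π : 𝒪[E] := ⟨ϖ, hϖ.mem⟩ with hπdef
  set πF : 𝒪[F] := ⟨ϖF, hϖF.mem⟩ with hπFdef
  have ha : ιO aF ∈ IsLocalRing.maximalIdeal 𝒪[E] := map_k₀_mem_maximalIdeal ιO hιu haF
  have hσπ : σO π = π := by rw [← hιϖ, hσι]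
  obtain ⟨c, hqc, hR⟩ := exists_coe_range_eval₂_eq_glued j θ hϖ hlam2 hN hn
  have hsub := image_prodMap_range_eval₂_subset_of_mem j σO σ₁ hσ₁j hstarmem
  rw [hR] at hsub
  have hherm : σO c - c ∈ Ideal.span ({π ^ n} : Set 𝒪[E]) :=
    map_sub_mem_span_of_image_prodMap_subset j θ σO σ₁ hcoord hσσ hσ₁j hσ₁θ hϖ hσπ hsub
  rcases level_of_eisenstein_pair j θ hθ ha hϖ hk₁ hcoord hlam2 hqc hN hn with ⟨hnodd, hc⟩ | ⟨M, hMN, hnM, -, hcM, hcM1⟩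
  · obtain ⟨y, hy, hlvl⟩ := exists_map_rep_of_level j θ σO ιO hσσ hfixO hcoord htr hϖF hϖ hιϖ hherm (Or.inl ⟨hnodd, hc⟩) hR
    refine ⟨y, hy, ?_⟩
    rcases hlvl with h | ⟨M, -, hMN, hnM, hyM, hyM1⟩
    · exact Or.inl h
    · exact Or.inr ⟨M, hMN, hnM, hyM, hyM1⟩
  · rcases Nat.eq_zero_or_pos M with hM0 | hMpos
    · -- `n = 0`: the glue is vacuous, take `y = 1`
      subst hM0
      have hn0 : n = 0 := by omega
      refine ⟨1, ?_, Or.inr ⟨0, Nat.zero_le N, hnM, ?_, ?_⟩⟩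
      · rw [hR]
        refine ((glued_eq_glued_iff j θ π hcoord N n (ιO 1) c hϖ.coe_ne_zero).2 ?_).symm
        rw [hn0, pow_zero, Ideal.span_singleton_one]
        exact Submodule.mem_top
      · rw [pow_zero, Ideal.span_singleton_one]; exact Submodule.mem_top
      · rw [zero_add, pow_one, hπFdef, ← hϖF.span_eq]
        exact (Ideal.ne_top_iff_one _).1 (IsLocalRing.maximalIdeal.isMaximal 𝒪[F]).ne_top
    · obtain ⟨y, hy, hlvl⟩ := exists_map_rep_of_level j θ σO ιO hσσ hfixO hcoord htr hϖF hϖ hιϖ hherm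
        (Or.inr ⟨M, hMpos, hMN, hnM, hcM, hcM1⟩) hR
      refine ⟨y, hy, ?_⟩
      rcases hlvl with h | ⟨M', -, hMN', hnM', hyM, hyM1⟩
      · exact Or.inl h
      · exact Or.inr ⟨M', hMN', hnM', hyM, hyM1⟩

/-- **(D′1, DEEP FORM).**  For a DEEP ⋆-stable Eisenstein pair (`u ≡ 1`, `p ≡ 1 (mod 𝔪_E)`) of exponents `(N, n)`:
`𝒪_E[(u, λ)] = G(N, n, ιO y)` with `y ∈ 𝒪_F` at a MONOGENIC level in exactly ★ (UG) `exists_unitary_generator_glued`'s `hlvl` tokens (`(b, N″) := (n, N)`):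
`(n = 2N+1 ∧ y ∈ (ϖ_F^{N+1})) ∨ ∃ M, 1 ≤ M ∧ M ≤ N ∧ n = 2M ∧ y ∈ (ϖ_F^M) ∧ y ∉ (ϖ_F^{M+1})`.
[cite: Rogawski1990, §4.9 Lemma 4.9.3 p. 56, Prop. 4.9.1 (b) p. 55] [cite: Neukirch1999, Ch. I §12] [cite: Jacobowitz1962, §7] [cite: SerreLocalFields1979, Ch. I §6 Prop. 17–18; Ch. X §1] -/
theorem exists_coe_range_eval₂_eq_glued_map_of_deep_of_star_mem {aF k₀F : 𝒪[F]}
    (hσσ : ∀ x, σO (σO x) = x) (hσι : ∀ y, σO (ιO y) = ιO y) (hfixO : ∀ x, σO x = x → ∃ y, ιO y = x)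
    (hιu : ∀ y, IsUnit (ιO y) → IsUnit y) (hσ₁j : ∀ x, σ₁ (j x) = j (σO x)) (hσ₁θ : σ₁ θ = θ)
    (hθ : θ ^ 2 = j (ιO aF) * θ + j (ιO k₀F)) (haF : aF ∈ IsLocalRing.maximalIdeal 𝒪[F])
    (hcoord : ∀ z : O₁, ∃! bc : 𝒪[E] × 𝒪[E], z = j bc.1 + j bc.2 * θ) (htr : ∃ b₀ : 𝒪[E], b₀ + σO b₀ = 1)
    {ϖF : F} {ϖ : E} (hϖF : IsUniformizingElement ϖF) (hϖ : IsUniformizingElement ϖ) (hιϖ : ιO ⟨ϖF, hϖF.mem⟩ = ⟨ϖ, hϖ.mem⟩)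
    (hk₁ : valuation E ((ιO k₀F : 𝒪[E]) : E) = valuation E ϖ) {u p q t D : 𝒪[E]}
    (hlam2 : (j p + j q * θ) ^ 2 - j t * (j p + j q * θ) + j D = 0)
    (hu1 : u - 1 ∈ IsLocalRing.maximalIdeal 𝒪[E]) (hp1 : p - 1 ∈ IsLocalRing.maximalIdeal 𝒪[E])
    (hstarmem : RingHom.prodMap σO σ₁ ((u, j p + j q * θ) : 𝒪[E] × O₁) ∈
      (Polynomial.eval₂RingHom (RingHom.prod (RingHom.id 𝒪[E]) j) ((u, j p + j q * θ) : 𝒪[E] × O₁)).range) {N n : ℕ}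
    (hN : valuation E (q : E) = valuation E ϖ ^ N) (hn : valuation E ((u * u - t * u + D : 𝒪[E]) : E) = valuation E ϖ ^ n) :
    ∃ y : 𝒪[F],
      ((Polynomial.eval₂RingHom (RingHom.prod (RingHom.id 𝒪[E]) j) ((u, j p + j q * θ) : 𝒪[E] × O₁)).range : Set (𝒪[E] × O₁)) =
        {z : 𝒪[E] × O₁ | ∃ b₀ c₀ : 𝒪[E], z.2 = j b₀ + j c₀ * (j ((⟨ϖ, hϖ.mem⟩ : 𝒪[E]) ^ N) * θ) ∧
          z.1 - (b₀ + c₀ * ιO y) ∈ Ideal.span {(⟨ϖ, hϖ.mem⟩ : 𝒪[E]) ^ n}} ∧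
      ((n = 2 * N + 1 ∧ y ∈ Ideal.span {(⟨ϖF, hϖF.mem⟩ : 𝒪[F]) ^ (N + 1)}) ∨
        ∃ M : ℕ, 1 ≤ M ∧ M ≤ N ∧ n = 2 * M ∧ y ∈ Ideal.span {(⟨ϖF, hϖF.mem⟩ : 𝒪[F]) ^ M} ∧
          y ∉ Ideal.span {(⟨ϖF, hϖF.mem⟩ : 𝒪[F]) ^ (M + 1)}) := by
  set π : 𝒪[E] := ⟨ϖ, hϖ.mem⟩ with hπdef
  have ha : ιO aF ∈ IsLocalRing.maximalIdeal 𝒪[E] := map_k₀_mem_maximalIdeal ιO hιu haF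
  have hσπ : σO π = π := by rw [← hιϖ, hσι]
  obtain ⟨c, hqc, hR⟩ := exists_coe_range_eval₂_eq_glued j θ hϖ hlam2 hN hn
  have hsub := image_prodMap_range_eval₂_subset_of_mem j σO σ₁ hσ₁j hstarmem
  rw [hR] at hsub
  have hherm : σO c - c ∈ Ideal.span ({π ^ n} : Set 𝒪[E]) :=
    map_sub_mem_span_of_image_prodMap_subset j θ σO σ₁ hcoord hσσ hσ₁j hσ₁θ hϖ hσπ hsub
  have hlvl := level_of_eisenstein_pair_of_deep j θ hθ ha hϖ hk₁ hcoord hlam2 hu1 hp1 hqc hN hn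
  have hlvl' : (n = 2 * N + 1 ∧ c ∈ Ideal.span ({π ^ (N + 1)} : Set 𝒪[E])) ∨
      ∃ M : ℕ, 1 ≤ M ∧ M ≤ N ∧ n = 2 * M ∧ c ∈ Ideal.span ({π ^ M} : Set 𝒪[E]) ∧ c ∉ Ideal.span ({π ^ (M + 1)} : Set 𝒪[E]) := by
    rcases hlvl with h | ⟨M, hM1, hMN, hnM, -, hcM, hcM1⟩
    · exact Or.inl h
    · exact Or.inr ⟨M, hM1, hMN, hnM, hcM, hcM1⟩
  exact exists_map_rep_of_level j θ σO ιO hσσ hfixO hcoord htr hϖF hϖ hιϖ hherm hlvl' hR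

end Star

end Literature.NumberTheory.Automorphic

end
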